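import Mathlib.Analysis.Complex.ExponentialBounds
import Summits.Ventures.WeilGRH.DualTrigFamilyUpgradesB
import Literature.NumberTheory.LFunctions.WeilExplicitDirichletConj
import HarnessLib

/-!
# The odd quartic characters mod 13 (census classes `13.5` / `13.8`) at `t = (log 5)/2` and at the ζ frontier `4023/5000`

Cell `rh-explicit`, WEIL TRACK — GRH ARM, route B (weil-grh-3, gen14).  The tree already holds the format-D-K kernel
certificate for the key class `(odd, χ(2) = −i, χ(3) = 1)` at every modulus `q ≥ 13`
(`weilPositivityOnChar_family_ge13_odd_chi2_negI_chi3_one_log5half`, `DualTrigFamilyUpgradesB.lean`, over gen2's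
`DualTrigCertMod13OddLog5Half`).  This file adds, with no new kernel work: the CONJUGATE key class `(odd, χ(2) = i,
χ(3) = 1)` through `weilPositivityOnChar_inv_iff` (conjugate characters share every rung); the two census characters mod 13
from ONE generator value `χ(2) = ±i` (parity and `χ(3) = χ(2)⁴ = 1` are derived from `−1 = 2⁶`, `3 = 2⁴` in `ZMod 13`);
and the ζ-frontier corollaries at `4023/5000 ≤ (log 5)/2` by `WeilPositivityOnChar.mono`.  These two characters are
below the odd uniform floor `14` of the frontier (`weilPositivityOnChar_frontier_of_odd_ge_fourteen`) and are not census
cells of `CensusFrontierDouble*`.  Honest scope: theorems for these characters and test functions supported in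
`[−(log 5)/2, (log 5)/2]` (resp. `[−4023/5000, 4023/5000]`).  No named facts, no `sorry`; axioms standard.
-/

namespace Summit.Ventures.WeilGRH

open Literature.NumberTheory.LFunctions

/-- **Key class `(odd, χ(2) = i, χ(3) = 1)` at `t = (log 5)/2`, every modulus `q ≥ 13`** — the conjugate of the tree's
`weilPositivityOnChar_family_ge13_odd_chi2_negI_chi3_one_log5half`, through `χ ↦ χ⁻¹`. [folklore] -/
theorem weilPositivityOnChar_family_ge13_odd_chi2_I_chi3_one_log5half {q : ℕ} (hq : 13 ≤ q) (χ : DirichletCharacter ℂ q)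
    (hpar : charParity χ = 1) (hχ2 : χ 2 = Complex.I) (hχ3 : χ 3 = 1) : WeilPositivityOnChar χ (Real.log 5 / 2) := by
  haveI : NeZero q := ⟨by omega⟩
  have hpar' : charParity χ⁻¹ = 1 := by rw [charParity_inv]; exact hpar
  have h2' : χ⁻¹ 2 = -Complex.I := by rw [MulChar.inv_apply_eq_inv', hχ2, Complex.inv_I]
  have h3' : χ⁻¹ 3 = 1 := by rw [MulChar.inv_apply_eq_inv', hχ3, inv_one]
  exact (weilPositivityOnChar_inv_iff χ (Real.log 5 / 2)).1
    (weilPositivityOnChar_family_ge13_odd_chi2_negI_chi3_one_log5half hq χ⁻¹ hpar' h2' h3')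

/-- **The ζ frontier for the key class `(odd, χ(2) = −i, χ(3) = 1)`, every modulus `q ≥ 13`.** [folklore] -/
theorem weilPositivityOnChar_frontier_ge13_odd_chi2_negI_chi3_one {q : ℕ} (hq : 13 ≤ q) (χ : DirichletCharacter ℂ q)
    (hpar : charParity χ = 1) (hχ2 : χ 2 = -Complex.I) (hχ3 : χ 3 = 1) : WeilPositivityOnChar χ (4023 / 5000) :=
  (weilPositivityOnChar_family_ge13_odd_chi2_negI_chi3_one_log5half hq χ hpar hχ2 hχ3).mono (by have h := Real.log_five_gt_d9; linarith)

/-- **The ζ frontier for the key class `(odd, χ(2) = i, χ(3) = 1)`, every modulus `q ≥ 13`.** [folklore] -/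
theorem weilPositivityOnChar_frontier_ge13_odd_chi2_I_chi3_one {q : ℕ} (hq : 13 ≤ q) (χ : DirichletCharacter ℂ q)
    (hpar : charParity χ = 1) (hχ2 : χ 2 = Complex.I) (hχ3 : χ 3 = 1) : WeilPositivityOnChar χ (4023 / 5000) :=
  (weilPositivityOnChar_family_ge13_odd_chi2_I_chi3_one_log5half hq χ hpar hχ2 hχ3).mono (by have h := Real.log_five_gt_d9; linarith)

/-- `i⁶ = −1`. [folklore] -/
theorem I_pow_six : Complex.I ^ 6 = -1 := by
  have h : Complex.I ^ 6 = (Complex.I ^ 2) ^ 3 := by ring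
  rw [h, Complex.I_sq]; norm_num

/-- **The odd quartic character mod 13 with `χ(2) = −i` (census pair `13.5`/`13.8`) at `t = (log 5)/2`** — one generator value:
`χ(−1) = χ(2)⁶ = −1`, `χ(3) = χ(2)⁴ = 1` (`−1 = 2⁶`, `3 = 2⁴` in `ZMod 13`). [folklore] -/
theorem weilPositivityOnChar_mod13_odd_chi2_negI_log5half (χ : DirichletCharacter ℂ 13) (hχ2 : χ 2 = -Complex.I) :
    WeilPositivityOnChar χ (Real.log 5 / 2) := by
  have hm1 : χ (-1) = -1 := by
    rw [show (-1 : ZMod 13) = 2 ^ 6 by decide, map_pow, hχ2, neg_pow, I_pow_six]; norm_num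
  have h3 : χ 3 = 1 := by
    rw [show (3 : ZMod 13) = 2 ^ 4 by decide, map_pow, hχ2, neg_pow, Complex.I_pow_four]; norm_num
  exact weilPositivityOnChar_family_ge13_odd_chi2_negI_chi3_one_log5half (le_refl 13) χ (charParity_of_odd hm1) hχ2 h3

/-- **The odd quartic character mod 13 with `χ(2) = i` at `t = (log 5)/2`** (the conjugate census class). [folklore] -/
theorem weilPositivityOnChar_mod13_odd_chi2_I_log5half (χ : DirichletCharacter ℂ 13) (hχ2 : χ 2 = Complex.I) :
    WeilPositivityOnChar χ (Real.log 5 / 2) := by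
  have hm1 : χ (-1) = -1 := by
    rw [show (-1 : ZMod 13) = 2 ^ 6 by decide, map_pow, hχ2, I_pow_six]
  have h3 : χ 3 = 1 := by
    rw [show (3 : ZMod 13) = 2 ^ 4 by decide, map_pow, hχ2, Complex.I_pow_four]
  exact weilPositivityOnChar_family_ge13_odd_chi2_I_chi3_one_log5half (le_refl 13) χ (charParity_of_odd hm1) hχ2 h3

/-- **The ζ frontier `4023/5000` for the odd quartic character mod 13 with `χ(2) = −i`.** [folklore] -/
theorem weilPositivityOnChar_mod13_odd_chi2_negI_frontier (χ : DirichletCharacter ℂ 13) (hχ2 : χ 2 = -Complex.I) :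
    WeilPositivityOnChar χ (4023 / 5000) :=
  (weilPositivityOnChar_mod13_odd_chi2_negI_log5half χ hχ2).mono (by have h := Real.log_five_gt_d9; linarith)

/-- **The ζ frontier `4023/5000` for the odd quartic character mod 13 with `χ(2) = i`.** [folklore] -/
theorem weilPositivityOnChar_mod13_odd_chi2_I_frontier (χ : DirichletCharacter ℂ 13) (hχ2 : χ 2 = Complex.I) :
    WeilPositivityOnChar χ (4023 / 5000) :=
  (weilPositivityOnChar_mod13_odd_chi2_I_log5half χ hχ2).mono (by have h := Real.log_five_gt_d9; linarith)

end Summit.Ventures.WeilGRH
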